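import Mathlib.Algebra.Group.Pointwise.Finset.Basic
import Mathlib.Algebra.BigOperators.Group.Finset.Basic
import Mathlib.Algebra.BigOperators.Fin
import Mathlib.Data.Fintype.Card
import Mathlib.Tactic.Abel
import HarnessLib

/-!
# The simultaneous double product property (Cohn–Kleinberg–Szegedy–Umans 2005, §4)

Trunk: Computability/AlgebraicComplexity. Companion of
`Literature.Computability.AlgebraicComplexity.IsSTPP` (file `GroupTheoreticMatMul.lean`, the
simultaneous TRIPLE product property): here the "two families" notion of CKSU 2005, §4, for `n`
pairs `(A i, B i)` of finite subsets of an ADDITIVE abelian group `H`.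

Cohn–Kleinberg–Szegedy–Umans 2005, §4 (FOCS numbering Def. 4.1 = "Definition 20" of the arXiv
text, p. 7): subsets `S₁, S₂` of a group satisfy the *double product property* if
`q₁ q₂ = 1 ⇒ q₁ = q₂ = 1` for `qᵢ ∈ Q(Sᵢ) = {s s'⁻¹ : s, s' ∈ Sᵢ}`; `n` pairs `(Aᵢ, Bᵢ)` satisfy
the *simultaneous double product property* (SDPP) if (i) every pair `(Aᵢ, Bᵢ)` has the double
product property and (ii) for all `i, j, k`, `aᵢ (a'ⱼ)⁻¹ bⱼ (b'ₖ)⁻¹ = 1` with `aᵢ ∈ Aᵢ`,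
`a'ⱼ ∈ Aⱼ`, `bⱼ ∈ Bⱼ`, `b'ₖ ∈ Bₖ` implies `i = k` (restated in Pratt 2024, Def. 2.4).
In an additive abelian group this reads

* (W) `∀ i, ∀ a a' ∈ A i, ∀ b b' ∈ B i, (a - a') + (b - b') = 0 → a = a' ∧ b = b'`
  (each `A i ⊕ B i` is direct), and
* (X) `∀ i j k, ∀ a ∈ A i, a' ∈ A j, b ∈ B j, b' ∈ B k, (a - a') + (b - b') = 0 → i = k`,

which are LITERALLY the two clauses inlined in the route statements
`MatrixMultiplication/GroupTheoreticSTPP.CPackingConstruction` (CKSU Conj. 4.7) and in every item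
of route `MatrixMultiplication/FourierTwoFamilies`; `isSDPP_iff` unfolds to them by `Iff.rfl`.

Proved API (all elementary):
* `IsSDPP.mono` (sub-pairs inherit the SDPP), `IsSDPP.reindex` (sub-families along an injection
  of indices), `isSDPP_zero` (the empty family);
* `simultaneous_iff_disjoint_sub` — CKSU's "convenient reformulation" (p. 7: the sets `Aᵢ⁻¹Bⱼ`
  with `i = j` are disjoint from those with `i ≠ j`), transcribed additively (`Aᵢ⁻¹Bⱼ` becomes
  the difference set `B j - A i`): (X) holds iff `B j - A j` and `B k - A i` are disjoint whenever
  `i ≠ k`; and the equivalent sumset form `simultaneous_iff_disjoint_add`: (X) holds iff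
  `A i + B j` and `A j + B k` are disjoint whenever `i ≠ k` (regroup `a + b = a' + b'`);
* `disjoint_left_of_simultaneous`, `disjoint_right_of_simultaneous`,
  `pairwiseDisjoint_of_simultaneous`, `IsSDPP.pairwiseDisjoint` — (X) with non-empty sets forces
  the `A i` pairwise disjoint and the `B i` pairwise disjoint (the first step of the proof of
  CKSU Prop. 4.6 = "Proposition 25" of the arXiv text, p. 8), hence `Σ |A i| ≤ |H|` and
  `Σ |B i| ≤ |H|` (`IsSDPP.sum_card_left_le`, `IsSDPP.sum_card_right_le`);
* `card_mul_card_le_of_dpp`, `IsSDPP.card_mul_card_le` — (W) makes `(a, b) ↦ a + b` injective on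
  `A i × B i`, so `|A i| |B i| ≤ |H|` (CKSU Prop. 4.6, the inequality `α ≤ β`);
* `isSDPP_univ_prod_singleton` — CKSU's "trivial example" (p. 7: `H = Cₙᵏ × Cₙ`,
  `Aᵢ = {(x, i)}`, `Bᵢ = {(0, i)}`), in the form `H = G × K`, `A i = univ ×ˢ {e i}`,
  `B i = {(0, e i)}` for any injection `e : Fin n → K`;
* `IsSDPP.prod` — Lemma 4.2 (= "Lemma 21" of the arXiv text, p. 7): the `n n'` product pairs
  `(Aᵢ × A'ⱼ, Bᵢ × B'ⱼ)` in `H × H'` of two SDPP families have the SDPP (indexed by `Fin (n * n')`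
  through `finProdFinEquiv`), and its iterate `IsSDPP.piPow` — the `N`-fold direct power in
  `H^N = (Fin N → H)`, `n ^ N` pairs indexed through `finFunctionFinEquiv` (the form used in the
  proofs of Thm. 4.4 and Prop. 4.6, p. 8: "by taking direct powers via Lemma 4.2, one can take `n`
  arbitrarily large without changing `α` and `β`").

Design notes: no non-emptiness or finiteness of `H` is built into `IsSDPP` (none is in the
source, and the routes quantify `Fintype H` separately); with an empty `A i` or `B i` both clauses
can hold vacuously while the other sets overlap, which is why the disjointness and `Σ`-bounds
below carry explicit `Nonempty` hypotheses.  `H : Type*` and `Finset`-valued families over `Fin n`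
exactly as in the routes; the multiplicative / non-abelian original is not needed by any requester.

What is NOT here: Thm. 4.3 (SDPP ⇒ TPP in a wreath product), Thm. 4.4 (the `ω` bound), Prop. 4.5
(the `C_m^{2ℓ}` construction), the second inequality `α + 2 ≤ 2β` of Prop. 4.6, Conj. 4.7 itself
(it is inlined in the routes named above) — separate items if wanted; none is asserted.

## References

* [CohnKleinbergSzegedyUmans2005] H. Cohn, R. Kleinberg, B. Szegedy, C. Umans, *Group-theoretic
  algorithms for matrix multiplication*, FOCS 2005, 379–388 = arXiv:math/0511460, §4: Def. 4.1
  (SDPP, with the reformulation and the trivial example following it), Prop. 4.6 (and its proof),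
  Conj. 4.7 — read from the held arXiv text, pp. 7–8 ("Definition 20", "Proposition 25",
  "Conjecture 26").
* [Pratt2024] K. Pratt, *On generalized corners and matrix multiplication*, ITCS 2024 =
  arXiv:2309.03878, Def. 2.4 (SDPP restated), Conj. 2.5.
-/

namespace Literature.Computability.AlgebraicComplexity

open Finset
open scoped Pointwise

variable {H : Type*} [AddCommGroup H] {n : ℕ}

/-- **Simultaneous double product property** (Cohn–Kleinberg–Szegedy–Umans 2005, §4, Def. 4.1;
Pratt 2024, Def. 2.4), additive form, for `n` pairs `(A i, B i)` of finite subsets of an additive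
abelian group `H`: (W) every pair has the double product property — `a, a' ∈ A i`, `b, b' ∈ B i`,
`(a - a') + (b - b') = 0` force `a = a'` and `b = b'` — and (X) simultaneity — `a ∈ A i`,
`a' ∈ A j`, `b ∈ B j`, `b' ∈ B k` with `(a - a') + (b - b') = 0` force `i = k`.
[cite: CohnKleinbergSzegedyUmans2005, §4 Def. 4.1] -/
def IsSDPP (A B : Fin n → Finset H) : Prop :=
  (∀ i : Fin n, ∀ a ∈ A i, ∀ a' ∈ A i, ∀ b ∈ B i, ∀ b' ∈ B i,
      (a - a') + (b - b') = 0 → a = a' ∧ b = b') ∧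
  (∀ i j k : Fin n, ∀ a ∈ A i, ∀ a' ∈ A j, ∀ b ∈ B j, ∀ b' ∈ B k,
      (a - a') + (b - b') = 0 → i = k)

/-- Unfolding `IsSDPP` to the two clauses inlined in the route statements (by `Iff.rfl`).
[folklore] -/
theorem isSDPP_iff (A B : Fin n → Finset H) :
    IsSDPP A B ↔
      (∀ i : Fin n, ∀ a ∈ A i, ∀ a' ∈ A i, ∀ b ∈ B i, ∀ b' ∈ B i,
          (a - a') + (b - b') = 0 → a = a' ∧ b = b') ∧
      (∀ i j k : Fin n, ∀ a ∈ A i, ∀ a' ∈ A j, ∀ b ∈ B j, ∀ b' ∈ B k,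
          (a - a') + (b - b') = 0 → i = k) :=
  Iff.rfl

/-- The empty family of pairs has the SDPP. [folklore] -/
theorem isSDPP_zero (A B : Fin 0 → Finset H) : IsSDPP A B :=
  ⟨fun i => i.elim0, fun i => i.elim0⟩

namespace IsSDPP

variable {A B : Fin n → Finset H}

/-- Clause (W) of the SDPP: each pair `(A i, B i)` has the double product property.
[cite: CohnKleinbergSzegedyUmans2005, §4 Def. 4.1] -/
theorem dpp (h : IsSDPP A B) (i : Fin n) {a a' b b' : H} (ha : a ∈ A i) (ha' : a' ∈ A i)
    (hb : b ∈ B i) (hb' : b' ∈ B i) (h0 : (a - a') + (b - b') = 0) : a = a' ∧ b = b' :=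
  h.1 i a ha a' ha' b hb b' hb' h0

/-- Clause (X) of the SDPP (simultaneity): `a ∈ A i`, `a' ∈ A j`, `b ∈ B j`, `b' ∈ B k` with
`(a - a') + (b - b') = 0` force `i = k`. [cite: CohnKleinbergSzegedyUmans2005, §4 Def. 4.1] -/
theorem simultaneous (h : IsSDPP A B) {i j k : Fin n} {a a' b b' : H} (ha : a ∈ A i)
    (ha' : a' ∈ A j) (hb : b ∈ B j) (hb' : b' ∈ B k) (h0 : (a - a') + (b - b') = 0) : i = k :=
  h.2 i j k a ha a' ha' b hb b' hb' h0

/-- Sub-pairs inherit the SDPP: if `A' i ⊆ A i` and `B' i ⊆ B i` for all `i`, then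
`IsSDPP A B → IsSDPP A' B'`. [folklore] -/
theorem mono {A' B' : Fin n → Finset H} (h : IsSDPP A B) (hA : ∀ i, A' i ⊆ A i)
    (hB : ∀ i, B' i ⊆ B i) : IsSDPP A' B' :=
  ⟨fun i a ha a' ha' b hb b' hb' h0 =>
      h.1 i a (hA i ha) a' (hA i ha') b (hB i hb) b' (hB i hb') h0,
    fun i j k a ha a' ha' b hb b' hb' h0 =>
      h.2 i j k a (hA i ha) a' (hA j ha') b (hB j hb) b' (hB k hb') h0⟩

/-- Sub-families inherit the SDPP: reindexing along an injection `ι : Fin m → Fin n` preserves it.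
[folklore] -/
theorem reindex {m : ℕ} (h : IsSDPP A B) (ι : Fin m → Fin n) (hι : Function.Injective ι) :
    IsSDPP (A ∘ ι) (B ∘ ι) :=
  ⟨fun i a ha a' ha' b hb b' hb' h0 => h.1 (ι i) a ha a' ha' b hb b' hb' h0,
    fun i j k a ha a' ha' b hb b' hb' h0 =>
      hι (h.2 (ι i) (ι j) (ι k) a ha a' ha' b hb b' hb' h0)⟩

end IsSDPP

section Simultaneous

variable {A B : Fin n → Finset H}

/-- **Simultaneity as disjointness of sumsets** (the abelian regrouping of CKSU's reformulation,
Cohn–Kleinberg–Szegedy–Umans 2005, §4, after Def. 4.1; see `simultaneous_iff_disjoint_sub` for the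
literal transcription): clause (X) holds iff the sumsets `A i + B j` and `A j + B k` are disjoint
whenever `i ≠ k` (indeed `(a - a') + (b - b') = 0 ↔ a + b = a' + b'`).
[cite: CohnKleinbergSzegedyUmans2005, §4 Def. 4.1] -/
theorem simultaneous_iff_disjoint_add [DecidableEq H] :
    (∀ i j k : Fin n, ∀ a ∈ A i, ∀ a' ∈ A j, ∀ b ∈ B j, ∀ b' ∈ B k,
        (a - a') + (b - b') = 0 → i = k) ↔
      ∀ i j k : Fin n, i ≠ k → Disjoint (A i + B j) (A j + B k) := by
  constructor
  · intro hX i j k hik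
    rw [Finset.disjoint_left]
    intro x hx hx'
    rw [Finset.mem_add] at hx hx'
    obtain ⟨a, ha, b, hb, rfl⟩ := hx
    obtain ⟨a', ha', b', hb', he⟩ := hx'
    refine hik (hX i j k a ha a' ha' b hb b' hb' ?_)
    rw [sub_add_sub_comm, ← he, sub_self]
  · intro hD i j k a ha a' ha' b hb b' hb' h0
    by_contra hik
    have he : a + b = a' + b' := by
      rw [sub_add_sub_comm] at h0
      exact sub_eq_zero.mp h0
    exact Finset.disjoint_left.mp (hD i j k hik) (Finset.add_mem_add ha hb)
      (he ▸ Finset.add_mem_add ha' hb')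

/-- **CKSU's reformulation of simultaneity, literal transcription** (Cohn–Kleinberg–Szegedy–Umans
2005, §4, after Def. 4.1: "A convenient reformulation is that if one looks at the sets
`Aᵢ⁻¹Bⱼ = {a⁻¹b : a ∈ Aᵢ, b ∈ Bⱼ}`, those with `i = j` are disjoint from those with `i ≠ j`"):
additively `Aᵢ⁻¹Bⱼ` is the difference set `B j - A i`, and clause (X) holds iff `B j - A j` and
`B k - A i` are disjoint whenever `i ≠ k` (indeed `(a - a') + (b - b') = 0 ↔ b - a' = b' - a`).
[cite: CohnKleinbergSzegedyUmans2005, §4 Def. 4.1] -/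
theorem simultaneous_iff_disjoint_sub [DecidableEq H] :
    (∀ i j k : Fin n, ∀ a ∈ A i, ∀ a' ∈ A j, ∀ b ∈ B j, ∀ b' ∈ B k,
        (a - a') + (b - b') = 0 → i = k) ↔
      ∀ i j k : Fin n, i ≠ k → Disjoint (B j - A j) (B k - A i) := by
  have key : ∀ a a' b b' : H, (a - a') + (b - b') = (b - a') - (b' - a) := fun a a' b b' => by
    abel
  constructor
  · intro hX i j k hik
    rw [Finset.disjoint_left]
    intro x hx hx'
    rw [Finset.mem_sub] at hx hx'
    obtain ⟨b, hb, a', ha', rfl⟩ := hx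
    obtain ⟨b', hb', a, ha, he⟩ := hx'
    refine hik (hX i j k a ha a' ha' b hb b' hb' ?_)
    rw [key, ← he, sub_self]
  · intro hD i j k a ha a' ha' b hb b' hb' h0
    by_contra hik
    have he : b - a' = b' - a := by
      rw [key] at h0
      exact sub_eq_zero.mp h0
    exact Finset.disjoint_left.mp (hD i j k hik) (Finset.sub_mem_sub hb ha')
      (he ▸ Finset.sub_mem_sub hb' ha)

/-- (Cohn–Kleinberg–Szegedy–Umans 2005, proof of Prop. 4.6: "`A₁, …, Aₙ` are disjoint (if
`x ∈ Aᵢ ∩ Aⱼ` with `i ≠ j`, and `y ∈ Bᵢ`, then `x⁻¹y ∈ (Aᵢ⁻¹Bᵢ) ∩ (Aⱼ⁻¹Bᵢ)`, which is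
impossible)".) Clause (X) alone, with `B j` non-empty, makes `A i` and `A j` disjoint for `i ≠ j`.
[cite: CohnKleinbergSzegedyUmans2005, Prop. 4.6 (proof)] -/
theorem disjoint_left_of_simultaneous
    (hX : ∀ i j k : Fin n, ∀ a ∈ A i, ∀ a' ∈ A j, ∀ b ∈ B j, ∀ b' ∈ B k,
        (a - a') + (b - b') = 0 → i = k)
    {i j : Fin n} (hij : i ≠ j) (hBj : (B j).Nonempty) : Disjoint (A i) (A j) := by
  rw [Finset.disjoint_left]
  intro x hxi hxj
  obtain ⟨y, hy⟩ := hBj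
  exact hij (hX i j j x hxi x hxj y hy y hy (by rw [sub_self, sub_self, add_zero]))

/-- (Cohn–Kleinberg–Szegedy–Umans 2005, proof of Prop. 4.6: "Similarly, `B₁, …, Bₙ` are also
disjoint.") Clause (X) alone, with `A j` non-empty, makes `B j` and `B k` disjoint for `j ≠ k`.
[cite: CohnKleinbergSzegedyUmans2005, Prop. 4.6 (proof)] -/
theorem disjoint_right_of_simultaneous
    (hX : ∀ i j k : Fin n, ∀ a ∈ A i, ∀ a' ∈ A j, ∀ b ∈ B j, ∀ b' ∈ B k,
        (a - a') + (b - b') = 0 → i = k)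
    {j k : Fin n} (hjk : j ≠ k) (hAj : (A j).Nonempty) : Disjoint (B j) (B k) := by
  rw [Finset.disjoint_left]
  intro y hyj hyk
  obtain ⟨x, hx⟩ := hAj
  exact hjk (hX j j k x hx x hx y hyj y hyk (by rw [sub_self, sub_self, add_zero]))

/-- **Pairwise disjointness** (Cohn–Kleinberg–Szegedy–Umans 2005, proof of Prop. 4.6): if clause
(X) holds and every `A i` and every `B i` is non-empty, then the `A i` are pairwise disjoint and
the `B i` are pairwise disjoint.  Stated literally as route item
`FourierTwoFamilies.PairwiseDisjoint` consumes it.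
[cite: CohnKleinbergSzegedyUmans2005, Prop. 4.6 (proof)] -/
theorem pairwiseDisjoint_of_simultaneous
    (hX : ∀ i j k : Fin n, ∀ a ∈ A i, ∀ a' ∈ A j, ∀ b ∈ B j, ∀ b' ∈ B k,
        (a - a') + (b - b') = 0 → i = k)
    (hne : ∀ i : Fin n, (A i).Nonempty ∧ (B i).Nonempty) :
    ∀ i j : Fin n, i ≠ j → Disjoint (A i) (A j) ∧ Disjoint (B i) (B j) :=
  fun i j hij =>
    ⟨disjoint_left_of_simultaneous hX hij (hne j).2,
      disjoint_right_of_simultaneous hX hij (hne i).1⟩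

/-- (Cohn–Kleinberg–Szegedy–Umans 2005, proof of Prop. 4.6: "the double product property … means
that the quotient map `(a, b) ↦ a⁻¹b` from `Aᵢ × Bᵢ` to `H` is injective", whence `|Aᵢ||Bᵢ| ≤ |H|`,
i.e. `α ≤ β`.) Additive form: clause (W) for one pair `(A, B)` makes `(a, b) ↦ a + b` injective on
`A ×ˢ B`, so `|A| |B| ≤ |H|`. [cite: CohnKleinbergSzegedyUmans2005, Prop. 4.6 (proof)] -/
theorem card_mul_card_le_of_dpp [Fintype H] {A B : Finset H}
    (hW : ∀ a ∈ A, ∀ a' ∈ A, ∀ b ∈ B, ∀ b' ∈ B, (a - a') + (b - b') = 0 → a = a' ∧ b = b') :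
    A.card * B.card ≤ Fintype.card H := by
  rw [← Finset.card_product, ← Finset.card_univ]
  refine Finset.card_le_card_of_injOn (fun p => p.1 + p.2) (fun p _ => Finset.mem_univ _) ?_
  intro p hp q hq hpq
  rw [Finset.mem_coe, Finset.mem_product] at hp hq
  have h0 : (p.1 - q.1) + (p.2 - q.2) = 0 := by
    rw [sub_add_sub_comm]
    exact sub_eq_zero.mpr hpq
  obtain ⟨h1, h2⟩ := hW p.1 hp.1 q.1 hq.1 p.2 hp.2 q.2 hq.2 h0
  exact Prod.ext h1 h2

end Simultaneous

namespace IsSDPP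

variable {A B : Fin n → Finset H}

/-- An SDPP family with all sets non-empty has the `A i` pairwise disjoint and the `B i` pairwise
disjoint (Cohn–Kleinberg–Szegedy–Umans 2005, proof of Prop. 4.6).
[cite: CohnKleinbergSzegedyUmans2005, Prop. 4.6 (proof)] -/
theorem pairwiseDisjoint (h : IsSDPP A B) (hne : ∀ i : Fin n, (A i).Nonempty ∧ (B i).Nonempty) :
    ∀ i j : Fin n, i ≠ j → Disjoint (A i) (A j) ∧ Disjoint (B i) (B j) :=
  pairwiseDisjoint_of_simultaneous h.2 hne

/-- In an SDPP family, `|A i| |B i| ≤ |H|` for every `i` (Cohn–Kleinberg–Szegedy–Umans 2005,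
Prop. 4.6, `α ≤ β`). [cite: CohnKleinbergSzegedyUmans2005, Prop. 4.6] -/
theorem card_mul_card_le [Fintype H] (h : IsSDPP A B) (i : Fin n) :
    (A i).card * (B i).card ≤ Fintype.card H :=
  card_mul_card_le_of_dpp (h.1 i)

/-- In an SDPP family with all `B i` non-empty, the `A i` are pairwise disjoint, so
`Σᵢ |A i| ≤ |H|` (Cohn–Kleinberg–Szegedy–Umans 2005, proof of Prop. 4.6).
[cite: CohnKleinbergSzegedyUmans2005, Prop. 4.6 (proof)] -/
theorem sum_card_left_le [Fintype H] (h : IsSDPP A B) (hB : ∀ i : Fin n, (B i).Nonempty) :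
    ∑ i, (A i).card ≤ Fintype.card H := by
  classical
  have hdisj : (↑(Finset.univ : Finset (Fin n)) : Set (Fin n)).PairwiseDisjoint A :=
    fun i _ j _ hij => disjoint_left_of_simultaneous h.2 hij (hB j)
  rw [← Finset.card_biUnion hdisj, ← Finset.card_univ (α := H)]
  exact Finset.card_le_card (Finset.subset_univ _)

/-- In an SDPP family with all `A i` non-empty, the `B i` are pairwise disjoint, so
`Σᵢ |B i| ≤ |H|` (Cohn–Kleinberg–Szegedy–Umans 2005, proof of Prop. 4.6).
[cite: CohnKleinbergSzegedyUmans2005, Prop. 4.6 (proof)] -/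
theorem sum_card_right_le [Fintype H] (h : IsSDPP A B) (hA : ∀ i : Fin n, (A i).Nonempty) :
    ∑ i, (B i).card ≤ Fintype.card H := by
  classical
  have hdisj : (↑(Finset.univ : Finset (Fin n)) : Set (Fin n)).PairwiseDisjoint B :=
    fun i _ j _ hij => disjoint_right_of_simultaneous h.2 hij (hA i)
  rw [← Finset.card_biUnion hdisj, ← Finset.card_univ (α := H)]
  exact Finset.card_le_card (Finset.subset_univ _)

end IsSDPP

/-- **CKSU's trivial example** (Cohn–Kleinberg–Szegedy–Umans 2005, §4, after Def. 4.1: "set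
`H = Cₙᵏ × Cₙ`, `Aᵢ = {(x, i) : x ∈ Cₙᵏ}` and `Bᵢ = {(0, i)}`. Then the pairs `Aᵢ, Bᵢ` for
`i ∈ Cₙ` satisfy the simultaneous double product property"), in the slightly more general form
`H = G × K`, `A i = univ ×ˢ {e i}`, `B i = {(0, e i)}` for a finite additive abelian group `G`, an
additive abelian group `K` and an injection `e : Fin n → K` (CKSU: `G = Cₙᵏ`, `K = Cₙ`, `e` the
obvious bijection). [cite: CohnKleinbergSzegedyUmans2005, §4 (example after Def. 4.1)] -/
theorem isSDPP_univ_prod_singleton {G K : Type*} [AddCommGroup G] [Fintype G] [AddCommGroup K]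
    (e : Fin n → K) (he : Function.Injective e) :
    IsSDPP (fun i => (Finset.univ : Finset G) ×ˢ ({e i} : Finset K))
      (fun i => ({((0 : G), e i)} : Finset (G × K))) := by
  refine ⟨fun i a _ a' _ b hb b' hb' h0 => ?_, fun i j k a ha a' ha' b hb b' hb' h0 => ?_⟩
  · rw [Finset.mem_singleton] at hb hb'
    subst hb hb'
    rw [sub_self, add_zero, sub_eq_zero] at h0
    exact ⟨h0, rfl⟩
  · rw [Finset.mem_product, Finset.mem_singleton] at ha ha'
    rw [Finset.mem_singleton] at hb hb'
    subst hb hb'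
    have h2 := congrArg Prod.snd h0
    rw [Prod.snd_add, Prod.snd_sub, Prod.snd_sub, Prod.snd_zero, ha.2, ha'.2,
      sub_add_sub_cancel, sub_eq_zero] at h2
    exact he h2

namespace IsSDPP

variable {A B : Fin n → Finset H}

/-- **Products of SDPP families** (Cohn–Kleinberg–Szegedy–Umans 2005, Lemma 4.2 = "Lemma 21" of
the arXiv text, p. 7: "If `n` pairs of subsets `Aᵢ, Bᵢ ⊆ H` satisfy the simultaneous double product
property, and `n'` pairs of subsets `A'ᵢ, B'ᵢ ⊆ H'` satisfy the simultaneous double product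
property, then so do the `nn'` pairs of subsets `Aᵢ × A'ⱼ, Bᵢ × B'ⱼ ⊆ H × H'`"), additive form;
the `n * n'` product pairs are indexed by `Fin (n * n')` through `finProdFinEquiv`.  Proof: both
clauses are checked coordinatewise, and in clause (X) the two coordinate conclusions `i = k`,
`i' = k'` give equality of the product indices. [cite: CohnKleinbergSzegedyUmans2005, Lemma 4.2] -/
theorem prod {H' : Type*} [AddCommGroup H'] {n' : ℕ} {A' B' : Fin n' → Finset H'}
    (h : IsSDPP A B) (h' : IsSDPP A' B') :
    IsSDPP (fun p : Fin (n * n') => A (finProdFinEquiv.symm p).1 ×ˢ A' (finProdFinEquiv.symm p).2)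
      (fun p : Fin (n * n') => B (finProdFinEquiv.symm p).1 ×ˢ B' (finProdFinEquiv.symm p).2) := by
  refine ⟨fun i a ha a' ha' b hb b' hb' h0 => ?_, fun i j k a ha a' ha' b hb b' hb' h0 => ?_⟩
  · rw [Finset.mem_product] at ha ha' hb hb'
    have h1 := congrArg Prod.fst h0
    have h2 := congrArg Prod.snd h0
    rw [Prod.fst_add, Prod.fst_sub, Prod.fst_sub, Prod.fst_zero] at h1
    rw [Prod.snd_add, Prod.snd_sub, Prod.snd_sub, Prod.snd_zero] at h2
    obtain ⟨e1, f1⟩ := h.1 _ _ ha.1 _ ha'.1 _ hb.1 _ hb'.1 h1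
    obtain ⟨e2, f2⟩ := h'.1 _ _ ha.2 _ ha'.2 _ hb.2 _ hb'.2 h2
    exact ⟨Prod.ext e1 e2, Prod.ext f1 f2⟩
  · rw [Finset.mem_product] at ha ha' hb hb'
    have h1 := congrArg Prod.fst h0
    have h2 := congrArg Prod.snd h0
    rw [Prod.fst_add, Prod.fst_sub, Prod.fst_sub, Prod.fst_zero] at h1
    rw [Prod.snd_add, Prod.snd_sub, Prod.snd_sub, Prod.snd_zero] at h2
    have e1 := h.2 _ _ _ _ ha.1 _ ha'.1 _ hb.1 _ hb'.1 h1
    have e2 := h'.2 _ _ _ _ ha.2 _ ha'.2 _ hb.2 _ hb'.2 h2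
    exact finProdFinEquiv.symm.injective (Prod.ext e1 e2)

/-- **Direct powers of an SDPP family** (Cohn–Kleinberg–Szegedy–Umans 2005, Lemma 4.2 iterated, in
the form used in the proofs of Thm. 4.4 — "Let `A'ᵢ, B'ᵢ` be the `N`-fold direct product of the
pairs `Aᵢ, Bᵢ` via Lemma 4.2" — and of Prop. 4.6 — "by taking direct powers via Lemma 4.2, one can
take `n` arbitrarily large without changing `α` and `β`", arXiv text p. 8): the `n ^ N` pairs
`(∏_c A (w c), ∏_c B (w c))`, `w : Fin N → Fin n`, of subsets of `H^N = (Fin N → H)` have the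
SDPP; they are indexed by `Fin (n ^ N)` through `finFunctionFinEquiv`, and the blocks are
`Fintype.piFinset`s, so `|∏_c A (w c)| = ∏_c |A (w c)|` (`Fintype.card_piFinset`).
[cite: CohnKleinbergSzegedyUmans2005, Lemma 4.2] -/
theorem piPow (h : IsSDPP A B) (N : ℕ) :
    IsSDPP
      (fun w : Fin (n ^ N) => Fintype.piFinset fun c : Fin N => A (finFunctionFinEquiv.symm w c))
      (fun w : Fin (n ^ N) =>
        Fintype.piFinset fun c : Fin N => B (finFunctionFinEquiv.symm w c)) := by
  refine ⟨fun i a ha a' ha' b hb b' hb' h0 => ?_, fun i j k a ha a' ha' b hb b' hb' h0 => ?_⟩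
  · rw [Fintype.mem_piFinset] at ha ha' hb hb'
    have hc : ∀ c, a c = a' c ∧ b c = b' c := fun c =>
      h.1 _ _ (ha c) _ (ha' c) _ (hb c) _ (hb' c) (by
        have h0c := congrFun h0 c
        rw [Pi.add_apply, Pi.sub_apply, Pi.sub_apply, Pi.zero_apply] at h0c
        exact h0c)
    exact ⟨funext fun c => (hc c).1, funext fun c => (hc c).2⟩
  · rw [Fintype.mem_piFinset] at ha ha' hb hb'
    apply finFunctionFinEquiv.symm.injective
    funext c
    exact h.2 _ _ _ _ (ha c) _ (ha' c) _ (hb c) _ (hb' c) (by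
      have h0c := congrFun h0 c
      rw [Pi.add_apply, Pi.sub_apply, Pi.sub_apply, Pi.zero_apply] at h0c
      exact h0c)

end IsSDPP

end Literature.Computability.AlgebraicComplexity
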